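import Literature.NumberTheory.EllipticCurves.NewformPeterssonSizeSymmSquareProofs
import Literature.NumberTheory.EllipticCurves.DeligneHeckeEigenvalueBoundProofs
import Literature.NumberTheory.LFunctions.GL2HarmonicFamily
import Mathlib.Analysis.SpecialFunctions.Trigonometric.Chebyshev.Basic
import HarnessLib

/-!
# Deligne's bound in divisor form at weight 2: `|λ_f(n)| ≤ d(n)` for newforms on `Γ₀(N)`

Topic `Literature/NumberTheory/LFunctions` (cell landau-siegel / ls-inputs, input I2 =
`bettin2017_theorem11_primeLevel`: the regime `m ≥ N^B` of Bettin 2017, Thm. 1.1, «otherwise the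
result is trivial», needs a UNIFORM bound for the Hecke eigenvalues).

GIVEN the tree's named fact `Deligne1974_heckeT_eigenvalue_norm_le` (Deligne 1974, Thm. 8.2: the
eigenvalues of `T_p` on `S_k(Γ₀(N))`, `p ∤ N`, have absolute value `≤ 2p^{(k−1)/2}`), every newform
`f ∈ S_2(Γ₀(N))` satisfies, in the analytic normalisation `λ_f(n) = a_f(n) n^{−1/2}`
(`GL2Family.heckeLambda`),

  `‖λ_f(n)‖ ≤ d(n)`  for all `n`  (`norm_heckeLambda_le_card_divisors_of_deligne`),

i.e. `‖a_f(n)‖ ≤ d(n)√n` (Iwaniec–Kowalski (14.54)/(5.93) shape of the Ramanujan–Petersson bound).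
Route: at `p ∤ N`, `λ_f(p^e) = S_e(λ_f(p))` with the Chebyshev polynomials
`S_e(2cos θ) = sin((e+1)θ)/sin θ` (Hecke recursion `a_{p^{e+2}} = a_p a_{p^{e+1}} − p a_{p^e}`,
tree `IsNewform0.re_cuspCoeff_prime_pow_add_two`) and `|λ_f(p)| ≤ 2` (Deligne), whence
`|λ_f(p^e)| ≤ e + 1` (`abs_chebyshevS_eval_le`, from `|sin(nθ)| ≤ n|sin θ|` on `(−2,2)` and
closedness at `±2`); at `p ∣ N`, `a_{p^e} = a_p^e` with `|a_p| ≤ 1` (Atkin–Lehner, tree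
`IsNewform0.norm_cuspCoeff_sq_of_dvd`); multiplicativity (`IsNewform0.coeff_mul_of_coprime_holds`) and
`d(mn) = d(m)d(n)` finish. Everything here is proved; no definition, no named fact.
-/

noncomputable section

open scoped Real
open Complex CongruenceSubgroup Polynomial
open Literature.NumberTheory.EllipticCurves.ModularForms

namespace Literature.NumberTheory.LFunctions.GL2Family

/-! ### Chebyshev: `|S_e(t)| ≤ e + 1` on `[−2, 2]` -/

/-- `|sin(nθ)| ≤ n |sin θ|`. [folklore] -/
private theorem abs_sin_nat_mul_le (θ : ℝ) (n : ℕ) :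
    |Real.sin (n * θ)| ≤ n * |Real.sin θ| := by
  induction n with
  | zero => simp
  | succ n ih =>
    have h : Real.sin (((n + 1 : ℕ) : ℝ) * θ) =
        Real.sin (n * θ) * Real.cos θ + Real.cos (n * θ) * Real.sin θ := by
      push_cast
      rw [add_mul, one_mul, Real.sin_add]
    rw [h]
    have h1 : |Real.sin (n * θ) * Real.cos θ| ≤ |Real.sin (n * θ)| := by
      rw [abs_mul]
      exact mul_le_of_le_one_right (abs_nonneg _) (Real.abs_cos_le_one θ)
    have h2 : |Real.cos (n * θ) * Real.sin θ| ≤ |Real.sin θ| := by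
      rw [abs_mul]
      exact mul_le_of_le_one_left (abs_nonneg _) (Real.abs_cos_le_one _)
    calc |Real.sin (n * θ) * Real.cos θ + Real.cos (n * θ) * Real.sin θ|
        ≤ |Real.sin (n * θ) * Real.cos θ| + |Real.cos (n * θ) * Real.sin θ| := abs_add_le _ _
      _ ≤ n * |Real.sin θ| + |Real.sin θ| := add_le_add (h1.trans ih) h2
      _ = ((n + 1 : ℕ) : ℝ) * |Real.sin θ| := by push_cast; ring

/-- **`|S_e(t)| ≤ e + 1` for `|t| ≤ 2`** (`S_e` Mathlib's Chebyshev polynomial with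
`S_e(2cos θ) sin θ = sin((e+1)θ)`; DLMF 18.14 shape of the classical bound `|U_e(x)| ≤ e + 1` on
`[−1, 1]`). [cite: DLMF, 18.14 (Chebyshev U bound)] -/
theorem abs_chebyshevS_eval_le {t : ℝ} (ht : |t| ≤ 2) (e : ℕ) :
    |(Chebyshev.S ℝ e).eval t| ≤ e + 1 := by
  -- on the open interval via `θ = arccos(t/2)`
  have hopen : ∀ u : ℝ, u ∈ Set.Ioo (-2 : ℝ) 2 → |(Chebyshev.S ℝ e).eval u| ≤ e + 1 := by
    intro u hu
    set θ := Real.arccos (u / 2) with hθ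
    have hu1 : -1 < u / 2 := by linarith [hu.1]
    have hu2 : u / 2 < 1 := by linarith [hu.2]
    have hcos : 2 * Real.cos θ = u := by
      rw [hθ, Real.cos_arccos hu1.le hu2.le]; ring
    have hθ0 : 0 < θ := Real.arccos_pos.mpr hu2
    have hθπ : θ < π := Real.arccos_lt_pi.mpr hu1
    have hsin : 0 < Real.sin θ := Real.sin_pos_of_pos_of_lt_pi hθ0 hθπ
    have key := Chebyshev.S_two_mul_real_cos θ (e : ℤ)
    rw [hcos] at key
    have hcast : (((e : ℤ) : ℝ) + 1) = ((e + 1 : ℕ) : ℝ) := by push_cast; ring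
    rw [hcast] at key
    have hb := abs_sin_nat_mul_le θ (e + 1)
    rw [← key, abs_mul, abs_of_pos hsin] at hb
    push_cast at hb
    exact le_of_mul_le_mul_right hb hsin
  -- closedness extends it to `[-2, 2]`
  have hclosed : IsClosed {u : ℝ | |(Chebyshev.S ℝ e).eval u| ≤ e + 1} :=
    isClosed_le (continuous_abs.comp (Polynomial.continuous _)) continuous_const
  have hsub : Set.Icc (-2 : ℝ) 2 ⊆ {u : ℝ | |(Chebyshev.S ℝ e).eval u| ≤ e + 1} := by
    rw [← closure_Ioo (by norm_num : (-2 : ℝ) ≠ 2)]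
    exact closure_minimal hopen hclosed
  exact hsub (abs_le.mp ht)

/-- A real sequence with `r₀ = 1`, `r₁ = t`, `r_{e+2} = t r_{e+1} − r_e` is `e ↦ S_e(t)`. [folklore] -/
private theorem eq_chebyshevS_of_rec {t : ℝ} {r : ℕ → ℝ} (h0 : r 0 = 1) (h1 : r 1 = t)
    (hrec : ∀ e, r (e + 2) = t * r (e + 1) - r e) (e : ℕ) :
    r e = (Chebyshev.S ℝ e).eval t := by
  induction e using Nat.strong_induction_on with
  | _ e ih =>
    match e with
    | 0 => simp [h0]
    | 1 => simp [h1]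
    | e + 2 =>
      rw [hrec e, ih (e + 1) (by omega), ih e (by omega)]
      have hS := Chebyshev.S_add_two ℝ (e : ℤ)
      have hc : ((e + 2 : ℕ) : ℤ) = (e : ℤ) + 2 := by push_cast; ring
      have hc1 : ((e + 1 : ℕ) : ℤ) = (e : ℤ) + 1 := by push_cast; ring
      rw [hc, hc1, hS]
      simp

/-! ### Prime powers -/

variable {N : ℕ} [NeZero N]

/-- **Good primes**: for a newform `f ∈ S_2(Γ₀(N))`, `p ∤ N`, granted Deligne's bound:
`‖a_f(p^e)‖ ≤ (e + 1) p^{e/2}` (`λ_f(p^e) = S_e(λ_f(p))`, `|λ_f(p)| ≤ 2`).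
[cite: Deligne1974, Thm. 8.2] -/
theorem norm_cuspCoeff_prime_pow_le_of_not_dvd (hD : Deligne1974_heckeT_eigenvalue_norm_le)
    {f : CuspForm (Gamma0 N) 2} (hf : IsNewform0 f) {p : ℕ} (hp : p.Prime) (hpN : ¬ p ∣ N)
    (e : ℕ) : ‖cuspCoeff f (p ^ e)‖ ≤ (e + 1) * Real.sqrt p ^ e := by
  have hp0 : (0 : ℝ) < p := by exact_mod_cast hp.pos
  have hs : 0 < Real.sqrt p := Real.sqrt_pos.mpr hp0
  -- the normalised real sequence `r_e = Re a_{p^e} / (√p)^e`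
  set r : ℕ → ℝ := fun e ↦ (cuspCoeff f (p ^ e)).re / Real.sqrt p ^ e with hr
  set t : ℝ := (cuspCoeff f p).re / Real.sqrt p with ht
  have h0 : r 0 = 1 := by
    simp only [hr, pow_zero]
    rw [show cuspCoeff f 1 = 1 from hf.2.2]; simp
  have h1 : r 1 = t := by simp [hr, ht]
  have hrec : ∀ e, r (e + 2) = t * r (e + 1) - r e := by
    intro e
    have h := hf.re_cuspCoeff_prime_pow_add_two hp e
    rw [if_neg hpN] at h
    simp only [hr, ht]
    rw [h]
    have hss : Real.sqrt p ^ 2 = p := by rw [sq, Real.mul_self_sqrt hp0.le]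
    field_simp
    linear_combination ((cuspCoeff f (p ^ e)).re * Real.sqrt p ^ (2 * e + 2)) * hss
  -- Deligne: `|t| ≤ 2`
  have hD' := hD.newform_coeff_bound N 2 le_rfl f hf p hp hpN
  rw [show (((2 : ℤ) : ℝ) - 1) / 2 = (1 / 2 : ℝ) by norm_num, ← Real.sqrt_eq_rpow] at hD'
  have htle : |t| ≤ 2 := by
    have hre : |(cuspCoeff f p).re| ≤ ‖cuspCoeff f p‖ := Complex.abs_re_le_norm _
    have h2 : ‖cuspCoeff f p‖ ≤ 2 * Real.sqrt p := hD'
    rw [ht, abs_div, abs_of_pos hs, div_le_iff₀ hs]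
    exact hre.trans h2
  -- conclude
  have hre := eq_chebyshevS_of_rec h0 h1 hrec e
  have hb := abs_chebyshevS_eval_le htle e
  rw [← hre, hr] at hb
  simp only at hb
  rw [abs_div, abs_of_pos (pow_pos hs e), div_le_iff₀ (pow_pos hs e)] at hb
  have him : (cuspCoeff f (p ^ e)).im = 0 := hf.cuspCoeff_im_eq_zero _
  have hnorm : ‖cuspCoeff f (p ^ e)‖ = |(cuspCoeff f (p ^ e)).re| := by
    rw [← Complex.re_add_im (cuspCoeff f (p ^ e)), him]
    simp
  rw [hnorm]
  exact hb

/-- **Bad primes**: for a newform `f ∈ S_2(Γ₀(N))` and `p ∣ N`: `‖a_f(p^e)‖ ≤ 1 ≤ (e+1)p^{e/2}`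
(`a_{p^e} = a_p^e`, `a_p² ∈ {0, 1}`; Atkin–Lehner 1970, Thm. 3). [cite: AtkinLehner1970, Thm. 3] -/
theorem norm_cuspCoeff_prime_pow_le_of_dvd {f : CuspForm (Gamma0 N) 2} (hf : IsNewform0 f)
    {p : ℕ} (hp : p.Prime) (hpN : p ∣ N) (e : ℕ) :
    ‖cuspCoeff f (p ^ e)‖ ≤ (e + 1) * Real.sqrt p ^ e := by
  have hap : ‖cuspCoeff f p‖ ≤ 1 := by
    have h := hf.norm_cuspCoeff_sq_of_dvd hp hpN
    have h1 : ‖cuspCoeff f p‖ ^ 2 ≤ 1 := by rw [h]; split_ifs <;> norm_num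
    nlinarith [norm_nonneg (cuspCoeff f p)]
  have h1 : ‖cuspCoeff f (p ^ e)‖ ≤ 1 := by
    rw [hf.cuspCoeff_prime_pow_of_dvd hp hpN e, norm_pow]
    exact pow_le_one₀ (norm_nonneg _) hap
  have hs1 : (1 : ℝ) ≤ Real.sqrt p := by
    rw [show (1 : ℝ) = Real.sqrt 1 by simp]
    exact Real.sqrt_le_sqrt (by exact_mod_cast hp.one_lt.le)
  calc ‖cuspCoeff f (p ^ e)‖ ≤ 1 := h1
    _ ≤ (e + 1) * Real.sqrt p ^ e := by
        have h2 : (1 : ℝ) ≤ Real.sqrt p ^ e := one_le_pow₀ hs1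
        have h3 : (1 : ℝ) ≤ e + 1 := by simp
        nlinarith

/-! ### All `n` -/

omit [NeZero N] in
/-- `a_f(0) = 0` for a cusp form on `Γ₀(N)` (cusp width `1` at `∞`). [folklore] -/
private theorem cuspCoeff_zero_gamma0 {k : ℤ} (f : CuspForm (Gamma0 N) k) : cuspCoeff f 0 = 0 :=
  cuspCoeff_zero (strictWidthInfty_Gamma0 N ▸ Subgroup.strictWidthInfty_mem_strictPeriods _) f

/-- **`‖a_f(n)‖ ≤ d(n) √n`** for a newform `f ∈ S_2(Γ₀(N))`, granted Deligne's bound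
(multiplicativity over prime powers). [cite: Deligne1974, Thm. 8.2] -/
theorem norm_cuspCoeff_le_card_divisors_mul_sqrt_of_deligne
    (hD : Deligne1974_heckeT_eigenvalue_norm_le) {f : CuspForm (Gamma0 N) 2} (hf : IsNewform0 f)
    (n : ℕ) : ‖cuspCoeff f n‖ ≤ (n.divisors.card : ℝ) * Real.sqrt n := by
  induction n using Nat.recOnPosPrimePosCoprime with
  | zero => simp [cuspCoeff_zero_gamma0]
  | one => rw [show cuspCoeff f 1 = 1 from hf.2.2]; simp
  | prime_pow p e hp he =>
    have hcard : ((p ^ e).divisors.card : ℝ) = e + 1 := by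
      rw [Nat.divisors_prime_pow hp, Finset.card_map, Finset.card_range]; push_cast; ring
    have hsqrt : Real.sqrt ((p ^ e : ℕ) : ℝ) = Real.sqrt p ^ e := by
      push_cast
      rw [Real.sqrt_eq_rpow, Real.sqrt_eq_rpow, ← Real.rpow_natCast, ← Real.rpow_natCast,
        ← Real.rpow_mul (by positivity), ← Real.rpow_mul (by positivity), mul_comm]
    rw [hcard, hsqrt]
    by_cases hpN : p ∣ N
    · exact norm_cuspCoeff_prime_pow_le_of_dvd hf hp hpN e
    · exact norm_cuspCoeff_prime_pow_le_of_not_dvd hD hf hp hpN e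
  | coprime a b ha hb hab iha ihb =>
    have hmul : cuspCoeff f (a * b) = cuspCoeff f a * cuspCoeff f b :=
      IsNewform0.coeff_mul_of_coprime_holds hf hab
    rw [hmul, norm_mul, Nat.Coprime.card_divisors_mul hab]
    push_cast
    rw [Real.sqrt_mul (Nat.cast_nonneg a)]
    calc ‖cuspCoeff f a‖ * ‖cuspCoeff f b‖
        ≤ ((a.divisors.card : ℝ) * Real.sqrt a) * ((b.divisors.card : ℝ) * Real.sqrt b) :=
          mul_le_mul iha ihb (norm_nonneg _) (by positivity)
      _ = (a.divisors.card : ℝ) * (b.divisors.card : ℝ) * (Real.sqrt a * Real.sqrt b) := by ring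

/-- **Deligne's bound in divisor form, weight 2**: granted `Deligne1974_heckeT_eigenvalue_norm_le`,
every newform `f ∈ S_2(Γ₀(N))` has `‖λ_f(n)‖ ≤ d(n)` for all `n` (`λ_f(n) = a_f(n) n^{−1/2}`,
`GL2Family.heckeLambda`; Iwaniec–Kowalski §14.9 shape of the Ramanujan–Petersson bound).
[cite: Deligne1974, Thm. 8.2] -/
theorem norm_heckeLambda_le_card_divisors_of_deligne (hD : Deligne1974_heckeT_eigenvalue_norm_le)
    {f : CuspForm (Gamma0 N) 2} (hf : IsNewform0 f) (n : ℕ) :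
    ‖heckeLambda f n‖ ≤ (n.divisors.card : ℝ) := by
  rcases Nat.eq_zero_or_pos n with rfl | hn
  · simp [heckeLambda, cuspCoeff_zero_gamma0]
  have hn0 : (0 : ℝ) < n := by exact_mod_cast hn
  have hs : 0 < Real.sqrt n := Real.sqrt_pos.mpr hn0
  have h := norm_cuspCoeff_le_card_divisors_mul_sqrt_of_deligne hD hf n
  rw [heckeLambda, norm_mul]
  have hpow : ‖(n : ℂ) ^ (-((((2 : ℤ) : ℂ) - 1) / 2))‖ = (Real.sqrt n)⁻¹ := by
    rw [show (-((((2 : ℤ) : ℂ) - 1) / 2)) = ((-(1 / 2 : ℝ) : ℝ) : ℂ) by push_cast; ring,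
      ← Complex.ofReal_natCast, ← Complex.ofReal_cpow hn0.le, Complex.norm_real,
      Real.norm_of_nonneg (Real.rpow_nonneg hn0.le _), Real.rpow_neg hn0.le, ← Real.sqrt_eq_rpow]
  rw [hpow]
  calc ‖cuspCoeff f n‖ * (Real.sqrt n)⁻¹ ≤ ((n.divisors.card : ℝ) * Real.sqrt n) * (Real.sqrt n)⁻¹ :=
        mul_le_mul_of_nonneg_right h (inv_nonneg.mpr hs.le)
    _ = (n.divisors.card : ℝ) := by field_simp

end Literature.NumberTheory.LFunctions.GL2Family

end
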